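import Summits.QuantumFields.BalabanUV.T4Continuum.Support.RegularBackgroundTower
import Literature.Analysis.Complex.RungeUnits

/-!
# T⁴ programme, spine node NE2 (U1a) — row B5, second half: EXPONENTIAL TRANSPORTERS `R = exp(L^{-k}A)` OF SMALL, LATTICE-LIPSCHITZ
# LIE-ALGEBRA DATA ARE `RegularTransporters` (the literal `U = e^{iηA}` reading of [B9] (3.35))

NE2 formalisation swarm, leaf prover 03, companion of `Support/RegularBackgroundTower` (row B5 of `t4/formal/NE2/LEAVES.md`).

WHAT THE PAPER PRINTS (documentation only, no cite tag — trigger condition c3; T. Bałaban, Commun. Math. Phys. **99** (1985) 389–434,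
p. 396 (3.35), quoted in full in `Support/RegularBackgroundTower`): in a cube of index `j` there is a gauge with `Uᵘ = e^{iηA}`,
`|A| < O(1)Mα₀(Lʲη)⁻¹`, `|∇^ηA| < O(1)Mα₀(Lʲη)⁻²`; p. 390: «a norm |X| of a N × N matrix means the Hilbert–Schmidt norm»; p. 400
(3.50): the perturbed covariant Laplacian carries the bond factors `exp iηad_{A′(b)} R(U_b)` — exponential transporters of the same shape.

WHAT IS TYPED HERE (GLOBAL small field, one cube of index `j = k`, lattice units `L^k = η⁻¹`, so the printed bounds read `‖A‖ ≤ α₁`,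
`‖A(x + e_μ) − A(x)‖ ≤ α₁/L^k` for the rescaled field `A′ = LʲηA` of [B9] p. 401): for matrix data `A^{(k)}_ν(x) ∈ M_o(ℂ)` (the printed
`iA` in any matrix representation — fundamental `o = Fin N`, or the adjoint generator on `𝔤`; no Hermiticity, no group structure used)
the EXPONENTIAL TRANSPORTERS **`expTransporters A k ν x = exp((L^k)⁻¹ • A^{(k)}_ν(x))`** satisfy
**`regularTransporters_exp`**: `‖A‖ ≤ α₁` and `‖A(x + e_μ) − A(x)‖ ≤ α₁/L^k` at every level ⟹
`RegularTransporters L M (expTransporters A) (α₁e^{α₁}) (α₁e^{α₁})`, i.e. SIZE `‖L^k(R − 1)‖ ≤ α₁e^{α₁}` and LATTICE-LIPSCHITZ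
`‖L^k(R(x + e_μ) − R(x))‖ ≤ α₁e^{α₁}/L^k` — by the tree's Banach-algebra Lipschitz bound `‖eˣ − eʸ‖ ≤ ‖x − y‖e^{max(‖x‖,‖y‖)}`
(`Literature.Analysis.Complex.norm_exp_sub_exp_le`) in `M_o(ℂ)` with the `ℓ²`-operator norm (`≤` the printed Hilbert–Schmidt norm, so
Hilbert–Schmidt hypotheses imply ours).  Hence every consumer of `Support/RegularBackgroundTower` (e.g.
`perturbationLaws_covariantLaplacian_of_regular`) may start from (3.35)-shape bounds on `A` itself: **`matrixHypotheses_of_exp`**.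

HONEST FRAMING (T4-DAG p. 1).  Elementary Banach-algebra bookkeeping; a hypothesis-to-hypothesis bridge, nothing asserted about Bałaban's
minimisers or about the existence of the regular gauge ([B8] CMP 99 75–102 — not used); model level; finite torus, linear layer, operator
norm; constants OURS (`α₁e^{α₁}`); NE2 NOT proved; NOT infinite volume, NOT a mass gap, NOT Clay, NOT summit progress; spine 0/9
unchanged.  HONEST DEPENDENCY: continuum YM on T⁴ ⇐ BetaPertH ∧ nine spine estimates (0/9 proved); BetaPertH ⇐ (D1) ∧ (D4) ∧ CAP+tail;
G-an2-4 gates asym, D1 and NE2/3/4.  ABSOLUTE RULE kept; no `sorry`.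
-/

noncomputable section

open scoped BigOperators Matrix Matrix.Norms.L2Operator
open NormedSpace

namespace Summit.QuantumFields.BalabanUV.T4Continuum.RegularTransportersExp

open Literature.MathematicalPhysics.QuantumFieldTheory.Balaban1983to89.B5Prop11Plancherel
open Literature.MathematicalPhysics.QuantumFieldTheory.Balaban1983to89.B5G183RateUnitTower (lev lev_neZero)
open Summit.QuantumFields.BalabanUV.T4Continuum
open Summit.QuantumFields.BalabanUV.T4Continuum.BalabanAveragedTowerUnit (idx one_le_lev' cast_lev')
open Summit.QuantumFields.BalabanUV.T4Continuum.BlockPairingGeometry (tau)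
open Summit.QuantumFields.BalabanUV.T4Continuum.RegularBackgroundTower

variable {d : ℕ} {o : Type*} [Fintype o] [DecidableEq o]

section Defs
variable (L : ℕ) (M : Fin d → ℕ)

/-- **EXPONENTIAL TRANSPORTERS** `R^{(k)}_ν(x) = exp((L^k)⁻¹ • A^{(k)}_ν(x))` — the printed `U = e^{iηA}`, `η = L^{-k}`, with the factor `i`
and the representation absorbed into the matrix data `A`. [folklore] -/
def expTransporters (A : (k : ℕ) → Fin d → (idx L M k → Matrix o o ℂ)) (k : ℕ) (ν : Fin d) (i : idx L M k) : Matrix o o ℂ :=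
  exp ((((lev L k : ℕ) : ℂ))⁻¹ • A k ν i)

end Defs

section Bounds
variable {L : ℕ} {M : Fin d → ℕ}

/-- `‖(L^k)⁻¹ • X‖ = ‖X‖/L^k`. [folklore] -/
theorem norm_inv_lev_smul (k : ℕ) (X : Matrix o o ℂ) : ‖(((lev L k : ℕ) : ℂ))⁻¹ • X‖ = ‖X‖ / (lev L k : ℕ) := by
  rw [norm_smul, norm_inv, Complex.norm_natCast, div_eq_inv_mul]

variable [NeZero L]

/-- `‖X‖/L^k ≤ ‖X‖` (`L^k ≥ 1`). [folklore] -/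
theorem norm_div_lev_le (k : ℕ) (X : Matrix o o ℂ) : ‖X‖ / (lev L k : ℕ) ≤ ‖X‖ :=
  div_le_self (norm_nonneg X) (by exact_mod_cast one_le_lev' L k)

variable [Nonempty o]

/-- SIZE of an exponential transporter: `‖L^k(exp((L^k)⁻¹A) − 1)‖ ≤ ‖A‖·e^{‖A‖}`. [folklore] -/
theorem norm_lev_smul_exp_sub_one_le (k : ℕ) (A : Matrix o o ℂ) :
    ‖((lev L k : ℕ) : ℂ) • (exp ((((lev L k : ℕ) : ℂ))⁻¹ • A) - 1)‖ ≤ ‖A‖ * Real.exp ‖A‖ := by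
  have hlev := lev_pos L k
  set X : Matrix o o ℂ := (((lev L k : ℕ) : ℂ))⁻¹ • A with hX
  have hXn : ‖X‖ = ‖A‖ / (lev L k : ℕ) := norm_inv_lev_smul k A
  have hXle : ‖X‖ ≤ ‖A‖ := hXn ▸ norm_div_lev_le k A
  have h := Literature.Analysis.Complex.norm_exp_sub_exp_le X 0
  rw [exp_zero, sub_zero, norm_zero, max_eq_left (norm_nonneg X)] at h
  rw [norm_smul, Complex.norm_natCast]
  calc ((lev L k : ℕ) : ℝ) * ‖exp X - 1‖ ≤ ((lev L k : ℕ) : ℝ) * (‖X‖ * Real.exp ‖X‖) := mul_le_mul_of_nonneg_left h hlev.le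
    _ ≤ ((lev L k : ℕ) : ℝ) * (‖A‖ / (lev L k : ℕ) * Real.exp ‖A‖) := by
        rw [hXn]; gcongr; exact norm_div_lev_le k A
    _ = ‖A‖ * Real.exp ‖A‖ := by field_simp

/-- LIPSCHITZ of exponential transporters: `‖L^k(exp((L^k)⁻¹A′) − exp((L^k)⁻¹A))‖ ≤ ‖A′ − A‖·e^{max(‖A′‖, ‖A‖)}`. [folklore] -/
theorem norm_lev_smul_exp_sub_exp_le (k : ℕ) (A' A : Matrix o o ℂ) :
    ‖((lev L k : ℕ) : ℂ) • (exp ((((lev L k : ℕ) : ℂ))⁻¹ • A') - exp ((((lev L k : ℕ) : ℂ))⁻¹ • A))‖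
      ≤ ‖A' - A‖ * Real.exp (max ‖A'‖ ‖A‖) := by
  have hlev := lev_pos L k
  set X' : Matrix o o ℂ := (((lev L k : ℕ) : ℂ))⁻¹ • A' with hX'
  set X : Matrix o o ℂ := (((lev L k : ℕ) : ℂ))⁻¹ • A with hX
  have hd : ‖X' - X‖ = ‖A' - A‖ / (lev L k : ℕ) := by rw [hX', hX, ← smul_sub, norm_inv_lev_smul]
  have hmax : max ‖X'‖ ‖X‖ ≤ max ‖A'‖ ‖A‖ :=
    max_le_max (by rw [hX', norm_inv_lev_smul]; exact norm_div_lev_le k A') (by rw [hX, norm_inv_lev_smul]; exact norm_div_lev_le k A)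
  have h := Literature.Analysis.Complex.norm_exp_sub_exp_le X' X
  rw [norm_smul, Complex.norm_natCast]
  calc ((lev L k : ℕ) : ℝ) * ‖exp X' - exp X‖ ≤ ((lev L k : ℕ) : ℝ) * (‖X' - X‖ * Real.exp (max ‖X'‖ ‖X‖)) :=
        mul_le_mul_of_nonneg_left h hlev.le
    _ ≤ ((lev L k : ℕ) : ℝ) * (‖A' - A‖ / (lev L k : ℕ) * Real.exp (max ‖A'‖ ‖A‖)) := by
        rw [hd]; gcongr
    _ = ‖A' - A‖ * Real.exp (max ‖A'‖ ‖A‖) := by field_simp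

end Bounds

section Tower
variable (L : ℕ) [NeZero L] (M : Fin d → ℕ) [Nonempty o]

/-- **EXPONENTIAL TRANSPORTERS OF SMALL, LATTICE-LIPSCHITZ DATA ARE `RegularTransporters`** (the `U = e^{iηA}` reading of (3.35),
GLOBAL small field): `‖A^{(k)}_ν(x)‖ ≤ α₁` and `‖A^{(k)}_ν(x + e_μ) − A^{(k)}_ν(x)‖ ≤ α₁/L^k` at every level give SIZE and
LATTICE-LIPSCHITZ constants `α₁e^{α₁}`.  A hypothesis-to-hypothesis bridge; nothing about Bałaban's minimisers is asserted. [folklore] -/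
theorem regularTransporters_exp {A : (k : ℕ) → Fin d → (idx L M k → Matrix o o ℂ)} {α₁ : ℝ} (hα : 0 ≤ α₁)
    (hsize : ∀ k ν (i : idx L M k), ‖A k ν i‖ ≤ α₁)
    (hlip : ∀ k ν μ (i : idx L M k), ‖A k ν (tau (fine (lev L k) M) μ i) - A k ν i‖ ≤ α₁ / (lev L k : ℕ)) :
    RegularTransporters L M (expTransporters L M A) (α₁ * Real.exp α₁) (α₁ * Real.exp α₁) where
  nonneg := ⟨by positivity, by positivity⟩
  size := fun k ν i => by
    show ‖((lev L k : ℕ) : ℂ) • (exp ((((lev L k : ℕ) : ℂ))⁻¹ • A k ν i) - 1)‖ ≤ α₁ * Real.exp α₁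
    refine (norm_lev_smul_exp_sub_one_le k (A k ν i)).trans ?_
    exact mul_le_mul (hsize k ν i) (Real.exp_le_exp.mpr (hsize k ν i)) (Real.exp_pos _).le hα
  lipschitz := fun k ν μ i => by
    show ‖((lev L k : ℕ) : ℂ) • (exp ((((lev L k : ℕ) : ℂ))⁻¹ • A k ν (tau (fine (lev L k) M) μ i))
        - exp ((((lev L k : ℕ) : ℂ))⁻¹ • A k ν i))‖ ≤ α₁ * Real.exp α₁ / (lev L k : ℕ)
    refine (norm_lev_smul_exp_sub_exp_le k _ _).trans ?_
    rw [mul_div_right_comm]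
    exact mul_le_mul (hlip k ν μ i) (Real.exp_le_exp.mpr (max_le (hsize k ν _) (hsize k ν i))) (Real.exp_pos _).le
      (div_nonneg hα (Nat.cast_nonneg _))

variable [hM : ∀ μ, NeZero (M μ)]

/-- **THE (3.35)-SHAPE BOUNDS ON `A` ITSELF FEED THE COVARIANT-LAPLACIAN EDGE**: the matrix-level hypotheses of
`Support/ColourCovariantLaplacian` for the exponential transporters, from `‖A‖ ≤ α₁`, `‖A(x + e_μ) − A(x)‖ ≤ α₁/L^k` and node NE3's
`LocalRate` on the class `{w, Dw}` of `R = expTransporters A` (binders displayed; `Support/RegularBackgroundTower.matrixBounds_of_regular_of_localRate`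
composed with `regularTransporters_exp`). [folklore] -/
theorem matrixHypotheses_of_exp {A : (k : ℕ) → Fin d → (idx L M k → Matrix o o ℂ)} {α₁ : ℝ} (hα : 0 ≤ α₁)
    (hsize : ∀ k ν (i : idx L M k), ‖A k ν i‖ ≤ α₁)
    (hlip : ∀ k ν μ (i : idx L M k), ‖A k ν (tau (fine (lev L k) M) μ i) - A k ν i‖ ≤ α₁ / (lev L k : ℕ)) {C : ℝ} (hC : 0 ≤ C)
    (hNE3 : Literature.MathematicalPhysics.QuantumFieldTheory.Balaban1983to89.T4EtaRateMin.LocalRate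
      (NE2FromNE3.bgReadings L M (regClass L M (expTransporters L M A))) C ((L : ℝ)⁻¹)) :
    ColourCovariantLaplacian.LipschitzBackgroundM L M
        (fun k ν i => ColourCovariantLaplacian.negConnM (fine (lev L k) M) ((lev L k : ℕ) : ℂ) (expTransporters L M A k) ν i)
        (α₁ * Real.exp α₁) (max (α₁ * Real.exp α₁) (betaNE3 o C)) ∧
      ColourCovariantLaplacian.BoundedBackgroundM L M
        (fun k i => ColourCovariantLaplacian.zfieldC (fine (lev L k) M) ((lev L k : ℕ) : ℂ) (expTransporters L M A k) i)
        (d * ((α₁ * Real.exp α₁) ^ 2 + 2 * (α₁ * Real.exp α₁)))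
        (d * (2 * (α₁ * Real.exp α₁) * (betaNE3 o C + α₁ * Real.exp α₁) + 2 * betaNE3 o C)) :=
  matrixBounds_of_regular_of_localRate L M (regularTransporters_exp L M hα hsize hlip) hC hNE3

end Tower

end Summit.QuantumFields.BalabanUV.T4Continuum.RegularTransportersExp

end
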